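import Literature.NumberTheory.EllipticCurves.MultiplicativeTransvectionPrimeToVProofs
import Literature.NumberTheory.EllipticCurves.MultiplicativeReductionJValuationProofs
import Literature.NumberTheory.DiophantineGeometry.GenEllMell
import Literature.IUT.LogVolume.Corollary22Statement
import HarnessLib

/-!
# [IUTchIV] Cor 2.2 (ii), step (P6): the Tate-curve input in the [GenEll] / `λ`-line vocabulary

Mochizuki, *Inter-universal Teichmüller theory IV*, RIMS manuscript (Apr. 2020; = PRIMS **57** (2021)),
proof of Cor. 2.2 (ii), p. 46: "This property (P5) [`𝕍^bad_mod ≠ ∅`: a valuation of bad multiplicative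
reduction not dividing `2l`] implies that (P6) the image of the outer homomorphism `Gal(Q̄/F) → GL₂(𝔽_l)`
determined by the `l`-torsion points of `E_F` contains the subgroup `SL₂(𝔽_l) ⊆ GL₂(𝔽_l)`. Indeed, since,
by (P5), `E_F` has bad multiplicative reduction at some valuation `∈ 𝕍^bad_mod ≠ ∅`, (P6) follows formally
from (P2) [`l` does not divide any nonzero `h_v`], (P4), and [GenEll], Lemma 3.1, (iii)".  The unprinted
classical input of "follows formally" is the Tate-curve fact that at such a valuation the Galois image
contains an element of order `l` (a transvection; Silverman, *ATAEC*, V.6 Prop. 6.1, Ex. 5.13 (b)).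

PROOF-ONLY file (theorems, no definitions): it reads the tree's number-field theorem
`WeierstrassCurve.exists_orderOf_galoisRepTorsion_eq_of_hasMultiplicativeReductionAt_of_not_dvd`
(`MultiplicativeTransvectionPrimeToVProofs`, hypotheses `v ∤ l`, `l ∤ ord_v(Δ_min)`) in the two
vocabularies the abc-iut consumers use, through the dictionary `ord_v(Δ_min) = -ord_v(j) = h_v` at a
multiplicative place (`MultiplicativeReductionJValuationProofs`):

* [GenEll] §3 (`EllPoint`, `EllPoint.localHeight v = -ord_v(j(E))` of `GenEllMell.lean`, the `h_v`
  of [GenEll] Def. 3.3 / Lem. 3.5 and of (P2)): `EllPoint.localHeight_eq_ordMinimalDiscriminant`,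
  `EllPoint.isPotMult_of_hasMultiplicativeReductionAt`, `EllPoint.natCast_dvd_localHeight_iff`,
  **`EllPoint.exists_orderOf_galoisRepTorsion_eq_of_not_dvd_localHeight`** (`l` prime, `v ∤ l`
  multiplicative, `l ∤ h_v` ⇒ some `σ ∈ Γ_F` is unipotent on `E[l]` with `orderOf ρ̄_{E,l}(σ) = l`),
  `EllPoint.dvd_card_range_galoisRepTorsion_of_not_dvd_localHeight` (`l ∣ #ρ̄_{E,l}(Γ_F)`);
* the `λ`-line of [IUTchIV] Cor. 2.2 (`NFPoint`, `Cor22.jInv`, `Cor22.localHeight` of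
  `Corollary22Statement.lean`), with the Legendre equation `y² = x(x−1)(x−λ)`, i.e. the Weierstrass
  curve `⟨0, −(1+λ), 0, λ, 0⟩` over the presenting field (written out, no definition introduced):
  `Cor22.isElliptic_legendre` (`λ ≠ 0, 1`), `Cor22.j_legendre` (`j = 2⁸(λ²−λ+1)³/(λ²(λ−1)²) = jInv λ`,
  Silverman *AEC* III.1.7), `Cor22.localHeight_eq_ordMinimalDiscriminant_legendre` (`h_v(λ) =
  ord_v(Δ_min)` at a multiplicative place), **`Cor22.exists_orderOf_galoisRepTorsion_eq_legendre`**.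

Classical, undisputed; the locators to [IUTchIV] only record WHERE the fact is consumed. Nothing here
bears on [IUTchIII] Cor. 3.12; typed ≠ discharged.
-/

noncomputable section

open NumberField IsDedekindDomain WeierstrassCurve

/-! ### [GenEll] vocabulary: `EllPoint` -/

namespace Literature.NumberTheory.DiophantineGeometry.GenEll.EllPoint

variable (P : EllPoint) {v : HeightOneSpectrum (𝓞 P.F)}

/-- **`h_v = ord_v(Δ_min)` at a place of multiplicative reduction**: the local height
`localHeight v = -ord_v(j(E))` ([GenEll] Def. 3.3 "`v_K(q_E) ∈ ℤ_{>0}`", Rmk. 3.3.1) equals the order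
of the minimal discriminant (Silverman *AEC* VII.5.1 (b): `v(c₄) = 0`, `j·Δ = c₄³`; the tree's
`log_valuation_j_eq_ordMinimalDiscriminant_of_hasMultiplicativeReductionAt`).
[cite: MochizukiGenEll2010, Def 3.3 p.15] [cite: SilvermanAEC2009, Prop. VII.5.1(b)] -/
theorem localHeight_eq_ordMinimalDiscriminant (hv : P.W.HasMultiplicativeReductionAt v) :
    P.localHeight v = (P.W.ordMinimalDiscriminant v : ℤ) := by
  unfold localHeight Literature.IUT.LogVolume.ord
  rw [neg_neg]
  exact P.W.log_valuation_j_eq_ordMinimalDiscriminant_of_hasMultiplicativeReductionAt v hv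

/-- A place of multiplicative reduction is a place of potentially multiplicative reduction
(`h_v = ord_v(Δ_min) ≥ 1`). [cite: MochizukiGenEll2010, Rmk 3.3.1 p.16] -/
theorem isPotMult_of_hasMultiplicativeReductionAt (hv : P.W.HasMultiplicativeReductionAt v) :
    P.IsPotMult v := by
  unfold IsPotMult
  rw [P.localHeight_eq_ordMinimalDiscriminant hv]
  have h := WeierstrassCurve.ordMinimalDiscriminant_ne_zero_of_hasMultiplicativeReductionAt v P.W hv
  omega

/-- "`l ∣ h_v`" read on the minimal discriminant: for `n : ℕ`, `(n : ℤ) ∣ h_v ↔ n ∣ ord_v(Δ_min)` at a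
multiplicative place. [cite: MochizukiGenEll2010, Lem 3.5 p.17] -/
theorem natCast_dvd_localHeight_iff (hv : P.W.HasMultiplicativeReductionAt v) (n : ℕ) :
    (n : ℤ) ∣ P.localHeight v ↔ n ∣ P.W.ordMinimalDiscriminant v := by
  rw [P.localHeight_eq_ordMinimalDiscriminant hv, Int.natCast_dvd_natCast]

/-- **The Tate-curve input of [IUTchIV] Cor. 2.2 (ii) (P6) / [GenEll] Thm. 3.8, [GenEll] vocabulary.**
For a presented elliptic curve `E_F` (`P : EllPoint`), a prime `l`, and a finite place `v` of `F` of
multiplicative reduction with `v ∤ l` and `l ∤ h_v` (the local height, [GenEll] Def. 3.3): some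
`σ ∈ Γ_F = Gal(F̄/F)` acts unipotently on `E[l]` (`σ(σQ − Q) = σQ − Q`) with `ρ̄_{E,l}(σ)` of order
exactly `l` — a non-trivial transvection (Silverman *ATAEC* V.6 Prop. 6.1; the tree's number-field theorem
`WeierstrassCurve.exists_orderOf_galoisRepTorsion_eq_of_hasMultiplicativeReductionAt_of_not_dvd`).
[cite: SilvermanATAEC1994, V.6 Prop. 6.1 (p. 410)] [cite: MochizukiGenEll2010, Thm 3.8 p.19] -/
theorem exists_orderOf_galoisRepTorsion_eq_of_not_dvd_localHeight {l : ℕ} (hl : l.Prime)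
    (hv : P.W.HasMultiplicativeReductionAt v) (hvl : (l : 𝓞 P.F) ∉ v.asIdeal)
    (hndvd : ¬ (l : ℤ) ∣ P.localHeight v) :
    ∃ σ : Field.absoluteGaloisGroup P.F,
      (∀ Q : P.W.geomTorsion (l : ℤ), σ • (σ • Q - Q) = σ • Q - Q) ∧
        orderOf (P.W.galoisRepTorsion (l : ℤ) σ) = l := by
  rw [P.natCast_dvd_localHeight_iff hv] at hndvd
  exact P.W.exists_orderOf_galoisRepTorsion_eq_of_hasMultiplicativeReductionAt_of_not_dvd hv hl hvl hndvd

/-- Under the same hypotheses, **`l` divides the order of the Galois image `ρ̄_{E,l}(Γ_F) ≤ Aut(E[l])`**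
(the form "`l ∣ #G`" of Serre 1972, Prop. 15, used with "no `l`-cyclic subgroup" to get
`SL₂(𝔽_l) ⊆ G`). [cite: SilvermanATAEC1994, V.6 Prop. 6.1 (p. 410)] [cite: MochizukiGenEll2010, Thm 3.8 p.19] -/
theorem dvd_card_range_galoisRepTorsion_of_not_dvd_localHeight {l : ℕ} (hl : l.Prime)
    (hv : P.W.HasMultiplicativeReductionAt v) (hvl : (l : 𝓞 P.F) ∉ v.asIdeal)
    (hndvd : ¬ (l : ℤ) ∣ P.localHeight v) :
    l ∣ Nat.card (P.W.galoisRepTorsion (l : ℤ)).range := by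
  rw [P.natCast_dvd_localHeight_iff hv] at hndvd
  exact P.W.dvd_card_range_galoisRepTorsion_of_hasMultiplicativeReductionAt_of_not_dvd hv hl hvl hndvd

end Literature.NumberTheory.DiophantineGeometry.GenEll.EllPoint

/-! ### The `λ`-line of [IUTchIV] Cor. 2.2: `NFPoint` and the Legendre equation -/

namespace Literature.IUT.LogVolume.Cor22

open Literature.NumberTheory.DiophantineGeometry.GenEll

variable (P : NFPoint)

/-- The Legendre equation `y² = x(x−1)(x−λ)`, i.e. the Weierstrass curve `⟨0, −(1+λ), 0, λ, 0⟩`, is an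
elliptic curve for `λ ∈ U_X(F)` (`λ ≠ 0, 1`): `Δ = 16λ²(λ−1)² ≠ 0` (Silverman *AEC*, proof of
VII.5.4 (c); the tree's `legendreForm_Δ`). [cite: SilvermanAEC2009, proof of Prop. VII.5.4(c) (PDF p. 176)] -/
theorem isElliptic_legendre (hP : P.InU) :
    (⟨0, -(1 + P.x), 0, P.x, 0⟩ : WeierstrassCurve P.F).IsElliptic := by
  rw [WeierstrassCurve.isElliptic_iff, WeierstrassCurve.legendreForm_Δ]
  refine (Ne.isUnit ?_)
  have h0 : P.x ≠ 0 := hP.1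
  have h1 : P.x - 1 ≠ 0 := sub_ne_zero.mpr hP.2
  have h16 : (16 : P.F) ≠ 0 := by norm_num
  exact mul_ne_zero h16 (pow_ne_zero 2 (mul_ne_zero h0 h1))

/-- **`j(y² = x(x−1)(x−λ)) = 2⁸(λ²−λ+1)³/(λ²(λ−1)²)`** (Silverman *AEC* III.1.7 (b)): the `j`-invariant of
the Legendre equation is the `jInv λ` of `Corollary22Statement.lean` ("the natural classifying morphism
`U_X → (M_ell)_ℚ`", [IUTchIV] p. 41). [cite: SilvermanAEC2009, Prop. III.1.7(b)] -/
theorem j_legendre (hP : P.InU) [hE : (⟨0, -(1 + P.x), 0, P.x, 0⟩ : WeierstrassCurve P.F).IsElliptic] :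
    (⟨0, -(1 + P.x), 0, P.x, 0⟩ : WeierstrassCurve P.F).j = jInv P.x := by
  have h0 : P.x ≠ 0 := hP.1
  have h1 : P.x - 1 ≠ 0 := sub_ne_zero.mpr hP.2
  rw [WeierstrassCurve.j, Units.val_inv_eq_inv_val, WeierstrassCurve.coe_Δ',
    WeierstrassCurve.legendreForm_c₄, WeierstrassCurve.legendreForm_Δ, jInv]
  field_simp
  ring

variable {P} in
/-- **`h_v(λ) = ord_v(Δ_min)` at a place of multiplicative reduction of the Legendre curve**: the local
height `Cor22.localHeight P v = max(0, −ord_v(j(λ)))` of `Corollary22Statement.lean` ([IUTchIV] p. 44: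
"`h_v ∈ ℕ_{≥1}` is the local height of `E_F` … for those `v` at which `E_F` has bad multiplicative
reduction") is the order of the minimal discriminant of `y² = x(x−1)(x−λ)` at `v`; integer form
`(−ord_v(j(λ))).toNat = ord_v(Δ_min)` first. [cite: Mochizuki2012, IUTchIV Cor 2.2 proof p.44]
[cite: SilvermanAEC2009, Prop. VII.5.1(b)] -/
theorem toNat_neg_ord_jInv_eq_ordMinimalDiscriminant_legendre (hP : P.InU)
    [hE : (⟨0, -(1 + P.x), 0, P.x, 0⟩ : WeierstrassCurve P.F).IsElliptic]
    {v : HeightOneSpectrum (𝓞 P.F)}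
    (hv : (⟨0, -(1 + P.x), 0, P.x, 0⟩ : WeierstrassCurve P.F).HasMultiplicativeReductionAt v) :
    (-(ord P.F v (jInv P.x))).toNat =
      (⟨0, -(1 + P.x), 0, P.x, 0⟩ : WeierstrassCurve P.F).ordMinimalDiscriminant v := by
  rw [← j_legendre P hP, Literature.IUT.LogVolume.ord, neg_neg,
    WeierstrassCurve.log_valuation_j_eq_ordMinimalDiscriminant_of_hasMultiplicativeReductionAt v _ hv,
    Int.toNat_natCast]

variable {P} in
/-- The real-valued form: `Cor22.localHeight P v = ord_v(Δ_min)` of the Legendre curve at a place of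
multiplicative reduction. [cite: Mochizuki2012, IUTchIV Cor 2.2 proof p.44] [cite: SilvermanAEC2009, Prop. VII.5.1(b)] -/
theorem localHeight_eq_ordMinimalDiscriminant_legendre (hP : P.InU)
    [hE : (⟨0, -(1 + P.x), 0, P.x, 0⟩ : WeierstrassCurve P.F).IsElliptic]
    {v : HeightOneSpectrum (𝓞 P.F)}
    (hv : (⟨0, -(1 + P.x), 0, P.x, 0⟩ : WeierstrassCurve P.F).HasMultiplicativeReductionAt v) :
    localHeight P v =
      ((⟨0, -(1 + P.x), 0, P.x, 0⟩ : WeierstrassCurve P.F).ordMinimalDiscriminant v : ℝ) := by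
  rw [localHeight, toNat_neg_ord_jInv_eq_ordMinimalDiscriminant_legendre hP hv]

variable {P} in
/-- **The Tate-curve input of [IUTchIV] Cor. 2.2 (ii) (P6) on the `λ`-line.**  For `λ ∈ U_X(F)`,
a prime `l` and a finite place `v ∤ l` of `F` at which `y² = x(x−1)(x−λ)` has (bad) multiplicative
reduction with `l ∤ h_v(λ)` ((P2) "`l` does not divide any nonzero `h_v`", with `v ∈ 𝕍^bad_mod`,
`v ∤ 2l`, of (P5)): some `σ ∈ Gal(F̄/F)` acts unipotently on the `l`-torsion of the Legendre curve with
image of order exactly `l` in `Aut(E[l])` — the element that, with (P4) and [GenEll] Lem. 3.1 (iii),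
gives `SL₂(𝔽_l) ⊆ Im(Gal(Q̄/F) → GL₂(𝔽_l))`. [cite: Mochizuki2012, IUTchIV Cor 2.2 proof (P6) p.46]
[cite: SilvermanATAEC1994, V.6 Prop. 6.1 (p. 410)] -/
theorem exists_orderOf_galoisRepTorsion_eq_legendre (hP : P.InU)
    [hE : (⟨0, -(1 + P.x), 0, P.x, 0⟩ : WeierstrassCurve P.F).IsElliptic]
    {l : ℕ} (hl : l.Prime) {v : HeightOneSpectrum (𝓞 P.F)}
    (hv : (⟨0, -(1 + P.x), 0, P.x, 0⟩ : WeierstrassCurve P.F).HasMultiplicativeReductionAt v)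
    (hvl : (l : 𝓞 P.F) ∉ v.asIdeal) (hndvd : ¬ l ∣ (-(ord P.F v (jInv P.x))).toNat) :
    ∃ σ : Field.absoluteGaloisGroup P.F,
      (∀ Q : (⟨0, -(1 + P.x), 0, P.x, 0⟩ : WeierstrassCurve P.F).geomTorsion (l : ℤ),
          σ • (σ • Q - Q) = σ • Q - Q) ∧
        orderOf ((⟨0, -(1 + P.x), 0, P.x, 0⟩ : WeierstrassCurve P.F).galoisRepTorsion (l : ℤ) σ) = l := by
  rw [toNat_neg_ord_jInv_eq_ordMinimalDiscriminant_legendre hP hv] at hndvd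
  exact WeierstrassCurve.exists_orderOf_galoisRepTorsion_eq_of_hasMultiplicativeReductionAt_of_not_dvd
    _ hv hl hvl hndvd

end Literature.IUT.LogVolume.Cor22

end
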